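import Summits.BirchSwinnertonDyer.BirchSwinnertonDyer.Theorems.EisensteinPrimesGoodLatticeBDPValueIndexInputsStub
import Summits.BirchSwinnertonDyer.BirchSwinnertonDyer.Theorems.SignedBaseChangeAnticyclotomicEisensteinDivisibilityLocalEulerPoincareCorank
import Literature.NumberTheory.IwasawaTheory.Greenberg2016.LocalCohomologyAlmostDivisible
import Literature.NumberTheory.IwasawaTheory.Greenberg2006.LocalH2VanishingOfLOC1
import Literature.NumberTheory.IwasawaTheory.Greenberg2006.GreenbergCohomologyFactsOfTateEuler
import Literature.NumberTheory.GaloisCohomology.RestrictedRamificationCdTwoOfPoitouTate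
import HarnessLib

/-!
# Crux `GoodLatticeBDPValue` (stmt-BirchSwinnertonDyer-19032), line `halves` v22: the PUBLISHED-input bundles
# `stub_publishedFactsGreenberg` (8 named facts) and `stub_publishedFactCD2` REDUCED to 3 research facts + 2 TEXTBOOK facts

Cell `bsd-eis` (run/shared/lean/pub/bsd-eis/), width seat `bsd-line-x1-p1-w2` gen 6 (D-0154 KEY row 4; director's item (2)
INPUTS→UNCONDITIONAL), `--supports stmt-BirchSwinnertonDyer-19032`. After v22 the registered line `halves` of crux 2 has no kernel
stub: the crux follows from 20 PUBLISHED named facts in four bundles and the PUB-composed residue 3a-A. This file shrinks the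
published input WITHOUT touching the composition, using discharges the tree already holds (Literature seats and the width seats of
the sibling crux `AnticyclotomicEisensteinDivisibility`, line `bdpline`, 2026-08-28):

* Greenberg 2016 Prop. 4.2.2 — `Greenberg2016.prop422_localCohomology_isAlmostDivisible_holds` (unconditional);
* Greenberg 2006 §5 A — `Greenberg2006.sec5A_localH2_subsingleton_of_LOC1_holds` (unconditional);
* Greenberg 2006 Prop. 4.2 — `Greenberg2006.prop42_localEulerPoincareCorank_holds` (unconditional, from Tate's local
  Euler–Poincaré characteristic proved in the tree);
* Greenberg 2006 Props. 3.2 and 4.1 — `Greenberg2006.prop32_cohomology_isCofinitelyGenerated_of_tate_of_poitouTate_three_le` and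
  `Greenberg2006.prop41_of_tate_of_poitouTate_three_le`, from the two TEXTBOOK named facts
  `GaloisCohomology.tateGlobalEulerPoincareCharacteristic` (Milne ADT I Thm. 5.1) and
  `GaloisCohomology.poitouTate_restricted_three_le` (Harari Thm. 17.13 (a));
* NSW (8.3.18) `cd_p(G_{K,S}) ≤ 2` at a totally complex `K` — `GaloisCohomology.groupCdLE_two_galoisGroupUnramifiedOutside_of_poitouTate`,
  from Harari Thm. 17.13 (a) again (the line's consumer `IndexInputsH2.natCard_H2_conjunct` uses the fact at the imaginary
  quadratic `K` only, although the registered stub 4c quantifies over every number field).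

Results (all sorry-free, no definition, no new named fact):

* §1 `publishedFactsGreenberg_of_textbook` — the registered statement of `stub_publishedFactsGreenberg` (its eight conjuncts,
  token for token) from FIVE hypotheses: Greenberg 2016 Prop. 4.1.1, BCGKPST 2020 §3.3, weak Leopoldt above the cyclotomic line
  (T4), and the two textbook facts;
* §2 `groupCdLE_two_of_poitouTate_of_isImaginaryQuadratic` — stub 4c's fact AT `K` imaginary quadratic from Harari 17.13 (a);
* §3 `indexInputs_of_textbook` — the closed stub 2a-I `GoodLatticeBDPValueIndexStubs.indexInputs` (v20.2, its statement from
  `∀ W` on VERBATIM) with its ten published antecedents replaced by THREE: Greenberg 2016 Prop. 2.6.3 and the two textbook facts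
  (same two-line proof: `IndexInputsShell.indexInputs_of_H2` + `IndexInputsH2.natCard_H2_conjunct`).

RESHAPE OPTION this affords the LEAD (not performed here): halves v23 with stub 4 := `prop411 ∧ sec33 ∧ T4 ∧ (∀ K, tateEPC K) ∧
(∀ K, PT-17.13(a) K)` (5 conjuncts, 2 of them textbook) and stub 4c DELETED — the line's named-fact count 20 → 16; the glue obtains
the old eight conjuncts from §1 and the `∀ L` antecedent of `indexInputs` is bypassed by §3. HONEST FRAMING: input bookkeeping
only; closes no stub by itself; no summit statement / BSD / KY Thm. 2.2.2 / the crux is proved here.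

References: [Greenberg2006] Props. 3.2, 4.1, 4.2, §5 A; [Greenberg2016Selmer] Props. 4.1.1, 4.2.2, 2.6.3; [MilneADT2006] I Thm. 5.1,
I Thm. 2.8; [Harari2020] Thm. 17.13 (a), Cor. 17.14, Cor. 17.17; [NeukirchSchmidtWingberg2008] (8.3.18), (8.3.20);
[BleherEtAl2020] §3.3; [NguyenQuangDo1984] Thm. 2.2; [KellerYin2024] §1.3–1.4.
-/

-- D-0017: single-problem summit, the namespace repeats the problem name by design.
set_option linter.dupNamespace false
set_option autoImplicit false

noncomputable section

open scoped Classical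

open PowerSeries WeierstrassCurve NumberField IsDedekindDomain Field
  Literature.NumberTheory.GaloisRepresentations Literature.NumberTheory.EllipticCurves.GreenbergVatsal2000
  Literature.NumberTheory.EllipticCurves Literature.NumberTheory.EllipticCurves.ModularForms
  Literature.NumberTheory.EllipticCurves.Rank1Residual Literature.NumberTheory.EllipticCurves.Castella2018
  Literature.NumberTheory.EllipticCurves.GreenbergSelmer Literature.NumberTheory.QuadraticFields
  Literature.NumberTheory.EllipticCurves.CastellaGrossiLeeSkinner2022
  Literature.NumberTheory.EllipticCurves.KellerYin2024 Literature.NumberTheory.EllipticCurves.IwasawaAlgebra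
  Literature.NumberTheory.EllipticCurves.BCGKPST2020
open Literature.NumberTheory.IwasawaTheory Literature.NumberTheory.IwasawaTheory.Greenberg2016
  Literature.NumberTheory.IwasawaTheory.Greenberg2006 Literature.NumberTheory.GaloisCohomology
open Summit.BirchSwinnertonDyer.Rank1Residual.X2.ResidualDevissageModules
  Summit.BirchSwinnertonDyer.BirchSwinnertonDyer.Theorems

namespace Summit.BirchSwinnertonDyer.BirchSwinnertonDyer.Theorems.GoodLatticeBDPValuePublishedFactsOfTextbook

/-! ### §1. Stub 4 `stub_publishedFactsGreenberg` (eight named facts) from three research facts and two textbook facts -/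

/-- **The registered statement of `stub_publishedFactsGreenberg` (halves v10–v22, eight conjuncts, token for token) from FIVE
hypotheses**: Greenberg 2016 Prop. 4.1.1 (`h411`), Tate's global Euler–Poincaré characteristic for every number field (`hT`,
Milne ADT I Thm. 5.1), Poitou–Tate in degrees `≥ 3` for every number field (`ha`, Harari Thm. 17.13 (a)), BCGKPST 2020 §3.3
(`h33`) and weak Leopoldt above the cyclotomic line in the open-subgroup form (`hT4`). The other three Greenberg conjuncts are
TREE THEOREMS (`prop422_…_holds`, `sec5A_…_holds`, `prop42_…_holds`) and Props. 3.2 / 4.1 follow from `hT`, `ha`.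
[cite: Greenberg2016Selmer, Prop. 4.1.1, Prop. 4.2.2] [cite: Greenberg2006, §5 A, Prop. 4.1, Prop. 4.2, Prop. 3.2]
[cite: MilneADT2006, I Thm. 5.1 (p. 67)] [cite: Harari2020, Thm. 17.13 (a), Cor. 17.17]
[cite: BleherEtAl2020, §3.3 Thm. 3.3.1] [cite: NguyenQuangDo1984, Thm. 2.2] -/
theorem publishedFactsGreenberg_of_textbook (h411 : prop411_selmer_isAlmostDivisible)
    (hT : ∀ (K : Type) [Field K] [NumberField K], tateGlobalEulerPoincareCharacteristic K)
    (ha : ∀ (K : Type) [Field K] [NumberField K], poitouTate_restricted_three_le K)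
    (h33 : BCGKPST2020.sec33_rubin_unrSelmer₂_finite_torsion)
    (hT4 : weakLeopoldt_H2_subsingleton_above_cyclotomic_of_isOpen) :
    prop411_selmer_isAlmostDivisible ∧ prop422_localCohomology_isAlmostDivisible ∧
      sec5A_localH2_subsingleton_of_LOC1 ∧ prop41_globalEulerPoincareCorank ∧
      prop42_localEulerPoincareCorank ∧ prop32_cohomology_isCofinitelyGenerated ∧
      BCGKPST2020.sec33_rubin_unrSelmer₂_finite_torsion ∧
      weakLeopoldt_H2_subsingleton_above_cyclotomic_of_isOpen :=
  ⟨h411, prop422_localCohomology_isAlmostDivisible_holds, sec5A_localH2_subsingleton_of_LOC1_holds,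
    prop41_of_tate_of_poitouTate_three_le hT ha, prop42_localEulerPoincareCorank_holds,
    prop32_cohomology_isCofinitelyGenerated_of_tate_of_poitouTate_three_le hT ha, h33, hT4⟩

/-! ### §2. Stub 4c `stub_publishedFactCD2` at the imaginary quadratic field, from Poitou–Tate 17.13 (a) -/

/-- **`cd_p(G_{K,S}) ≤ 2` at an imaginary quadratic `K` from Harari Thm. 17.13 (a)** (an imaginary quadratic field is totally
complex, so the tree's `groupCdLE_two_galoisGroupUnramifiedOutside_of_poitouTate` applies): the ONLY instance of stub 4c the
line consumes (`IndexInputsH2.natCard_H2_conjunct (hCD2 K)`). [cite: Harari2020, Thm. 17.13 (a), Cor. 17.14 (p. 295)]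
[cite: NeukirchSchmidtWingberg2008, (8.3.18)] -/
theorem groupCdLE_two_of_poitouTate_of_isImaginaryQuadratic {K : Type} [Field K] [NumberField K]
    (ha : poitouTate_restricted_three_le K) (hK : IsImaginaryQuadratic K) :
    groupCdLE_two_galoisGroupUnramifiedOutside K :=
  haveI : IsTotallyComplex K := hK.2
  groupCdLE_two_galoisGroupUnramifiedOutside_of_poitouTate ha

/-! ### §3. The closed stub 2a-I `indexInputs` with THREE published antecedents instead of ten -/

/-- **`GoodLatticeBDPValueIndexStubs.indexInputs` (closed stub 2a-I of halves v20.2) from Greenberg 2016 Prop. 2.6.3 and the two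
textbook facts only**: the statement from `∀ W` on is the registered one VERBATIM; of the ten published antecedents of the landed
theorem, Props. 4.1.1 / 4.2.2, BCGKPST §3.3 and T4 were never used by its proof, §5 A / Prop. 4.2 are tree theorems, Props. 3.2 /
4.1 come from Tate + Poitou–Tate, and `cd_p ≤ 2` is needed at the imaginary quadratic `K` only (§2). Same two-line proof as the
landed theorem (`IndexInputsShell.indexInputs_of_H2` + `IndexInputsH2.natCard_H2_conjunct`).
[cite: KellerYin2024, Prop. 1.3.2 and §1.4 (arXiv:2402.12781v2 TeX L700–760, L1178–1330)] [cite: PollackWeston2011, Prop. A.2]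
[cite: Greenberg2016Selmer, Prop. 2.6.3] [cite: MilneADT2006, I Thm. 5.1] [cite: Harari2020, Thm. 17.13 (a), Cor. 17.14] -/
theorem indexInputs_of_textbook :
    prop263_sur_of_crk →
    (∀ (L : Type) [Field L] [NumberField L], tateGlobalEulerPoincareCharacteristic L) →
    (∀ (L : Type) [Field L] [NumberField L], poitouTate_restricted_three_le L) →
    ∀ (W : WeierstrassCurve ℚ) [W.IsElliptic] [W.IsGloballyMinimal] (p : ℕ) [Fact p.Prime],
      2 < p → Good W p → Red W p → Anom W p →
      (∀ Φ : AddSubgroup (geomTorsion W (p : ℤ)), IsRationalLine W p Φ → ¬ LineUnramifiedAt W p Φ) →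
      ∀ (K : Type) [Field K] [NumberField K], IsImaginaryQuadratic K →
        SatisfiesHeegnerHypothesis (W.conductorNorm ℤ) K → SatisfiesHeegnerHypothesis p K →
        (∀ Q : (W.baseChange K).toAffine.Point, p • Q = 0 → Q = 0) →
      ∀ (ι : K →+* ℚ_[p]) (v vbar : HeightOneSpectrum (𝓞 K)),
        (∀ x : 𝓞 K, x ∈ v.asIdeal ↔ ‖ι (x : K)‖ < 1) →
        ((p : ℕ) : 𝓞 K) ∈ vbar.asIdeal → vbar ≠ v →
      ∀ (κ : ZpExtension K p), κ.IsAnticyclotomic →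
      ∀ (γ : absoluteGaloisGroup K) [Fact (κ.IsTopGenerator γ)],
      ∀ (θsub θquot : FramedGaloisRep K (padicCoeffIntegers (∅ : Set (PadicAlgCl p))) 1),
        IsResidualPairOver (W.baseChange K) p θsub θquot →
      ∀ (Sf : Finset (HeightOneSpectrum (𝓞 K))),
        (∀ w : HeightOneSpectrum (𝓞 K), w ∈ Sf ↔ ((W.conductorNorm ℤ : ℤ) : 𝓞 K) ∈ w.asIdeal) →
      Module.Finite (IwasawaAlgebra p) (AcSelmer.XAc (W.baseChange K) p κ vbar (↑Sf : Set (HeightOneSpectrum (𝓞 K))) γ) →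
      Module.IsTorsion (IwasawaAlgebra p) (AcSelmer.XAc (W.baseChange K) p κ vbar (↑Sf : Set (HeightOneSpectrum (𝓞 K))) γ) →
      muInvariant p (AcSelmer.XAc (W.baseChange K) p κ vbar (↑Sf : Set (HeightOneSpectrum (𝓞 K))) γ) = 0 →
      (∀ D : DatumDualData κ γ (charModule ∅ θsub)
          (AcSelmer.bdpData (charModule ∅ θsub) p vbar) (↑Sf : Set (HeightOneSpectrum (𝓞 K))),
        Module.Finite (IwasawaAlgebra p) D.X ∧ Module.IsTorsion (IwasawaAlgebra p) D.X ∧ muInvariant p D.X = 0) →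
      (∀ D : DatumDualData κ γ (charModule ∅ θquot)
          (AcSelmer.bdpData (charModule ∅ θquot) p vbar) (↑Sf : Set (HeightOneSpectrum (𝓞 K))),
        Module.Finite (IwasawaAlgebra p) D.X ∧ Module.IsTorsion (IwasawaAlgebra p) D.X ∧ muInvariant p D.X = 0) →
      ∃ (c : ℕ) (τ : ℕ → absoluteGaloisGroup K)
        (Φ : StableSubgroup (absoluteGaloisGroup K) ↥((W.baseChange K).geomTorsion (p : ℤ)))
        (j₁ : Φ.Sub →+ charModule ∅ θsub) (j₃ : Φ.Quot →+ charModule ∅ θquot)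
        (hj₁ : ∀ (g : absoluteGaloisGroup K) (a : Φ.Sub), j₁ (g • a) = g • j₁ a)
        (hj₃ : ∀ (g : absoluteGaloisGroup K) (a : Φ.Quot), j₃ (g • a) = g • j₃ a),
        -- (R) representatives
        (∀ i : ℕ, κ (τ i) = Multiplicative.ofAdd ((i : ℕ) : ℤ_[p])) ∧
        (∀ i j : ℕ, i < p ^ c → j < p ^ c → i ≠ j → ∀ δ ∈ decomp vbar,
          Multiplicative.ofAdd ((j : ℕ) : ℤ_[p]) ≠ Multiplicative.ofAdd ((i : ℕ) : ℤ_[p]) * κ δ) ∧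
        (∀ x : subgroupH1 κ.kerSubgroup (charModule ∅ θsub),
          (∀ i, i < p ^ c → resOfLe (charModule ∅ θsub) (inf_le_left : κ.kerSubgroup ⊓ decomp vbar ≤ κ.kerSubgroup) (conjH1 κ.kerSubgroup (charModule ∅ θsub) (τ i) x) = 0) →
            ∀ σ : absoluteGaloisGroup K, resOfLe (charModule ∅ θsub) (inf_le_left : κ.kerSubgroup ⊓ decomp vbar ≤ κ.kerSubgroup) (conjH1 κ.kerSubgroup (charModule ∅ θsub) σ x) = 0) ∧
        (∀ x : subgroupH1 κ.kerSubgroup ↥((W.baseChange K).geomPrimaryTorsion p),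
          (∀ i, i < p ^ c → resOfLe ↥((W.baseChange K).geomPrimaryTorsion p) (inf_le_left : κ.kerSubgroup ⊓ decomp vbar ≤ κ.kerSubgroup) (conjH1 κ.kerSubgroup ↥((W.baseChange K).geomPrimaryTorsion p) (τ i) x) = 0) →
            ∀ σ : absoluteGaloisGroup K, resOfLe ↥((W.baseChange K).geomPrimaryTorsion p) (inf_le_left : κ.kerSubgroup ⊓ decomp vbar ≤ κ.kerSubgroup) (conjH1 κ.kerSubgroup ↥((W.baseChange K).geomPrimaryTorsion p) σ x) = 0) ∧
        (∀ x : subgroupH1 κ.kerSubgroup (charModule ∅ θquot),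
          (∀ i, i < p ^ c → resOfLe (charModule ∅ θquot) (inf_le_left : κ.kerSubgroup ⊓ decomp vbar ≤ κ.kerSubgroup) (conjH1 κ.kerSubgroup (charModule ∅ θquot) (τ i) x) = 0) →
            ∀ σ : absoluteGaloisGroup K, resOfLe (charModule ∅ θquot) (inf_le_left : κ.kerSubgroup ⊓ decomp vbar ≤ κ.kerSubgroup) (conjH1 κ.kerSubgroup (charModule ∅ θquot) σ x) = 0) ∧
        -- the Kummer embeddings
        Function.Injective j₁ ∧ Function.Injective j₃ ∧
        (∀ x : charModule ∅ θsub, x ∈ j₁.range ↔ p • x = 0) ∧ (∀ x : charModule ∅ θquot, x ∈ j₃.range ↔ p • x = 0) ∧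
        (∀ x : ↥((W.baseChange K).geomPrimaryTorsion p), x ∈ (AddSubgroup.inclusion (geomTorsion_le_geomPrimaryTorsion (W.baseChange K) p)).range ↔ p • x = 0) ∧
        (∀ x : ↥((W.baseChange K).geomPrimaryTorsion p), ∃ x' : ↥((W.baseChange K).geomPrimaryTorsion p), p • x' = x) ∧
        -- (U)
        (∀ w : HeightOneSpectrum (𝓞 K), w ∉ (↑Sf : Set (HeightOneSpectrum (𝓞 K))) → ((p : ℕ) : 𝓞 K) ∉ w.asIdeal →
          Function.Injective (resH1Hom (ContinuousMonoidHom.id (inertiaIn κ.kerSubgroup w)) Φ.incl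
            (fun g m ↦ Φ.incl_smul ((g : decomp (K := K) w) : absoluteGaloisGroup K) m))) ∧
        (∀ w : HeightOneSpectrum (𝓞 K), w ∉ (↑Sf : Set (HeightOneSpectrum (𝓞 K))) → ((p : ℕ) : 𝓞 K) ∉ w.asIdeal →
          Function.Injective (resH1Hom (ContinuousMonoidHom.id (inertiaIn κ.kerSubgroup w)) j₁
            (fun g m ↦ hj₁ ((g : decomp (K := K) w) : absoluteGaloisGroup K) m))) ∧
        (∀ w : HeightOneSpectrum (𝓞 K), w ∉ (↑Sf : Set (HeightOneSpectrum (𝓞 K))) → ((p : ℕ) : 𝓞 K) ∉ w.asIdeal →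
          Function.Injective (resH1Hom (ContinuousMonoidHom.id (inertiaIn κ.kerSubgroup w)) (AddSubgroup.inclusion (geomTorsion_le_geomPrimaryTorsion (W.baseChange K) p))
            (fun (g : inertiaIn κ.kerSubgroup w) (m : ↥((W.baseChange K).geomTorsion (p : ℤ))) ↦
              (rfl : (AddSubgroup.inclusion (geomTorsion_le_geomPrimaryTorsion (W.baseChange K) p)) (((g : decomp (K := K) w) : absoluteGaloisGroup K) • m) =
                ((g : decomp (K := K) w) : absoluteGaloisGroup K) • (AddSubgroup.inclusion (geomTorsion_le_geomPrimaryTorsion (W.baseChange K) p)) m)))) ∧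
        (∀ w : HeightOneSpectrum (𝓞 K), w ∉ (↑Sf : Set (HeightOneSpectrum (𝓞 K))) → ((p : ℕ) : 𝓞 K) ∉ w.asIdeal →
          Function.Injective (resH1Hom (ContinuousMonoidHom.id (inertiaIn κ.kerSubgroup w)) j₃
            (fun g m ↦ hj₃ ((g : decomp (K := K) w) : absoluteGaloisGroup K) m))) ∧
        -- SUR
        (∀ y : Fin (p ^ c) → subgroupH1 (κ.kerSubgroup ⊓ decomp vbar) (charModule ∅ θsub), ∃ u ∈ unramifiedOutside κ.kerSubgroup (charModule ∅ θsub) p (↑Sf : Set (HeightOneSpectrum (𝓞 K))),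
          ∀ i : Fin (p ^ c), resOfLe (charModule ∅ θsub) (inf_le_left : κ.kerSubgroup ⊓ decomp vbar ≤ κ.kerSubgroup) (conjH1 κ.kerSubgroup (charModule ∅ θsub) (τ i) u) = y i) ∧
        (∀ y : Fin (p ^ c) → subgroupH1 (κ.kerSubgroup ⊓ decomp vbar) ↥((W.baseChange K).geomPrimaryTorsion p), ∃ u ∈ unramifiedOutside κ.kerSubgroup ↥((W.baseChange K).geomPrimaryTorsion p) p (↑Sf : Set (HeightOneSpectrum (𝓞 K))),
          ∀ i : Fin (p ^ c), resOfLe ↥((W.baseChange K).geomPrimaryTorsion p) (inf_le_left : κ.kerSubgroup ⊓ decomp vbar ≤ κ.kerSubgroup) (conjH1 κ.kerSubgroup ↥((W.baseChange K).geomPrimaryTorsion p) (τ i) u) = y i) ∧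
        (∀ y : Fin (p ^ c) → subgroupH1 (κ.kerSubgroup ⊓ decomp vbar) (charModule ∅ θquot), ∃ u ∈ unramifiedOutside κ.kerSubgroup (charModule ∅ θquot) p (↑Sf : Set (HeightOneSpectrum (𝓞 K))),
          ∀ i : Fin (p ^ c), resOfLe (charModule ∅ θquot) (inf_le_left : κ.kerSubgroup ⊓ decomp vbar ≤ κ.kerSubgroup) (conjH1 κ.kerSubgroup (charModule ∅ θquot) (τ i) u) = y i) ∧
        -- COT
        (∀ s : (datumStrictSelmer κ.kerSubgroup (charModule ∅ θsub) p (AcSelmer.bdpData (charModule ∅ θsub) p vbar) (↑Sf : Set (HeightOneSpectrum (𝓞 K)))), ∃ n : ℕ, p ^ n • s = 0) ∧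
        (∀ s : (datumStrictSelmer κ.kerSubgroup ↥((W.baseChange K).geomPrimaryTorsion p) p (AcSelmer.bdpData ↥((W.baseChange K).geomPrimaryTorsion p) p vbar) (↑Sf : Set (HeightOneSpectrum (𝓞 K)))), ∃ n : ℕ, p ^ n • s = 0) ∧
        (∀ s : (datumStrictSelmer κ.kerSubgroup (charModule ∅ θquot) p (AcSelmer.bdpData (charModule ∅ θquot) p vbar) (↑Sf : Set (HeightOneSpectrum (𝓞 K)))), ∃ n : ℕ, p ^ n • s = 0) ∧
        Finite (AddSubgroup.torsionBy (datumStrictSelmer κ.kerSubgroup (charModule ∅ θsub) p (AcSelmer.bdpData (charModule ∅ θsub) p vbar) (↑Sf : Set (HeightOneSpectrum (𝓞 K)))) (p : ℤ)) ∧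
        Finite (AddSubgroup.torsionBy (datumStrictSelmer κ.kerSubgroup ↥((W.baseChange K).geomPrimaryTorsion p) p (AcSelmer.bdpData ↥((W.baseChange K).geomPrimaryTorsion p) p vbar) (↑Sf : Set (HeightOneSpectrum (𝓞 K)))) (p : ℤ)) ∧
        Finite (AddSubgroup.torsionBy (datumStrictSelmer κ.kerSubgroup (charModule ∅ θquot) p (AcSelmer.bdpData (charModule ∅ θquot) p vbar) (↑Sf : Set (HeightOneSpectrum (𝓞 K)))) (p : ℤ)) ∧
        -- global H⁰
        (∀ x : (charModule ∅ θsub), (∀ g : ↥κ.kerSubgroup, g • x = x) → ∃ x' : (charModule ∅ θsub), (∀ g : ↥κ.kerSubgroup, g • x' = x') ∧ p • x' = x) ∧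
        (∀ x : ↥((W.baseChange K).geomPrimaryTorsion p), (∀ g : ↥κ.kerSubgroup, g • x = x) → ∃ x' : ↥((W.baseChange K).geomPrimaryTorsion p), (∀ g : ↥κ.kerSubgroup, g • x' = x') ∧ p • x' = x) ∧
        (∀ x : (charModule ∅ θquot), (∀ g : ↥κ.kerSubgroup, g • x = x) → ∃ x' : (charModule ∅ θquot), (∀ g : ↥κ.kerSubgroup, g • x' = x') ∧ p • x' = x) ∧
        (∀ n : ↥((W.baseChange K).geomTorsion (p : ℤ)), (∀ g : ↥κ.kerSubgroup, g • n = n) → n = 0) ∧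
        Finite {n : Φ.Quot // ∀ g : ↥κ.kerSubgroup, g • n = n} ∧
        Nat.card {n : Φ.Quot // ∀ g : ↥κ.kerSubgroup, g • n = n} = p ^ (if ∀ σ : absoluteGaloisGroup K, θquot σ = 1 then 1 else 0) ∧
        -- local H⁰ at `H ⊓ D_v̄`
        (∀ n : Φ.Sub, (∀ g : ↥(κ.kerSubgroup ⊓ decomp vbar), g • n = n) → n = 0) ∧
        (∀ (g : ↥(κ.kerSubgroup ⊓ decomp vbar)) (n : Φ.Quot), g • n = n) ∧
        Finite Φ.Quot ∧ Nat.card Φ.Quot = p ∧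
        (∀ x : (charModule ∅ θsub), (∀ g : ↥(κ.kerSubgroup ⊓ decomp vbar), g • x = x) → ∃ x' : (charModule ∅ θsub), (∀ g : ↥(κ.kerSubgroup ⊓ decomp vbar), g • x' = x') ∧ p • x' = x) ∧
        (∀ x : (charModule ∅ θquot), (∀ g : ↥(κ.kerSubgroup ⊓ decomp vbar), g • x = x) → ∃ x' : (charModule ∅ θquot), (∀ g : ↥(κ.kerSubgroup ⊓ decomp vbar), g • x' = x') ∧ p • x' = x) ∧
        -- H² bookkeeping
        Nat.card (↥(unramifiedOutside κ.kerSubgroup Φ.Quot p (↑Sf : Set (HeightOneSpectrum (𝓞 K)))) ⧸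
            ((unramifiedOutside κ.kerSubgroup ↥((W.baseChange K).geomTorsion (p : ℤ)) p (↑Sf : Set (HeightOneSpectrum (𝓞 K)))).map (resH1Hom (ContinuousMonoidHom.id ↥κ.kerSubgroup) Φ.proj
              (fun g b ↦ Φ.proj_smul (g : absoluteGaloisGroup K) b))).addSubgroupOf
                (unramifiedOutside κ.kerSubgroup Φ.Quot p (↑Sf : Set (HeightOneSpectrum (𝓞 K))))) *
            Nat.card (ModN (unramifiedOutside κ.kerSubgroup ↥((W.baseChange K).geomPrimaryTorsion p) p (↑Sf : Set (HeightOneSpectrum (𝓞 K)))) p) =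
          Nat.card (ModN (unramifiedOutside κ.kerSubgroup (charModule ∅ θsub) p (↑Sf : Set (HeightOneSpectrum (𝓞 K)))) p) * Nat.card (ModN (unramifiedOutside κ.kerSubgroup (charModule ∅ θquot) p (↑Sf : Set (HeightOneSpectrum (𝓞 K)))) p) := by
  intro h263 hT ha W _ _ p _ hp hgood hred hanom hlat K _ _ hK hH hHp htor ι v vbar hv hvbar hne
    κ hκ γ _ θsub θquot hpair Sf hSf hfgS htorS hμS hSsub hSquot
  have h41 : prop41_globalEulerPoincareCorank := prop41_of_tate_of_poitouTate_three_le hT ha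
  have h32 : prop32_cohomology_isCofinitelyGenerated :=
    prop32_cohomology_isCofinitelyGenerated_of_tate_of_poitouTate_three_le hT ha
  exact IndexInputsShell.indexInputs_of_H2 h263 h41 prop42_localEulerPoincareCorank_holds
    sec5A_localH2_subsingleton_of_LOC1_holds h32 W p hp hanom hlat K hK hH htor ι v vbar hv hvbar hne κ hκ γ
    θsub θquot hpair Sf hSf hfgS htorS hμS hSsub hSquot
    (fun Φ j₁ j₃ hj₁ hj₃ _ _ hj₁inj hj₃inj hr₁ hr₃ ↦ IndexInputsH2.natCard_H2_conjunct
      (groupCdLE_two_of_poitouTate_of_isImaginaryQuadratic (ha K) hK) h41 prop42_localEulerPoincareCorank_holds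
      sec5A_localH2_subsingleton_of_LOC1_holds h32 W hp hK hH hv
      hvbar hne κ hκ γ hpair Sf hSf hSsub hSquot Φ j₁ j₃ hj₁ hj₃ hj₁inj hj₃inj hr₁ hr₃)

end Summit.BirchSwinnertonDyer.BirchSwinnertonDyer.Theorems.GoodLatticeBDPValuePublishedFactsOfTextbook

end
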